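import Literature.MathematicalPhysics.KineticTheory.HardSphereMeanCollisionCount
import Summits.AtomisticToContinuum.HydrodynamicLimit.Theorems.JParityClosureOddContactSymmetryGibbsInvariance
import Summits.AtomisticToContinuum.HydrodynamicLimit.Theorems.JParityClosureCollisionTightnessSweptTube
import Summits.AtomisticToContinuum.HydrodynamicLimit.Theorems.JParityClosureCollisionTightnessTorusGibbs
import Summits.AtomisticToContinuum.HydrodynamicLimit.Theorems.RelayRaceLocalityNearConstantShortTimeHLMeansNecessaryStatic
import HarnessLib

/-!
# Crux `RestartPrinciple` (stmt-AtomisticToContinuum-12503), line `IdeatorFourSketch` — the collision-flux hypothesis of the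
# momentum reduction of `stub_meanMapRegularity` (stmt-AtomisticToContinuum-15330) HOLDS AT CONSTANT PROFILES

Support file (`--supports stmt-AtomisticToContinuum-12503`; registered sub-goal `mmr_collisionFlux_const`). The reduction
`mmr_momentum_of_collisionFlux` (`…RestartPrincipleMmrMomentum`) turns the momentum clause of `ResponseRigidity.MeanMapRegularity`
into the mean relative-speed collision-flux bound
`(ε_N/(N+1)) · E_{LG_τ}[Σ_{collision times r ∈ [0,s]} Σ_{ordered contact pairs (i,k)} ‖vᵢ(r) − v_k(r)‖] ≤ C_K s + e_K(N)`
along the Euler activity family. This file records that the hypothesis is EXACTLY the tree's collision-flux bound read at the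
flow-evolved laws, by discharging it where the law is invariant — constant profiles `a, θ > 0`, `u`, the homogeneous Gibbs law
`G_N = localGibbsLaw σ a u θ N Φ`, every `0 < σ ≤ 1/2`, every flow, every `N`, with `C_K = 80 σ³ (3θ + ‖u‖²)`, `e_K = 0`:
`localGibbsLaw_lintegral_le_of_le_collisionMarkSum` (Cercignani–Illner–Pulvirenti 1994 App. 4.A, `CollisionFluxMeanBound`)
with the mark `‖vᵢ − v_k‖`, its inputs being in the tree — invariance of `G_N` under every hard-sphere flow
(`measurePreserving_flow_localGibbsLaw_const`), the canonical pair bound `≤ 5 · Haar` (`posGibbs_pairEvent_le_five`), the swept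
tubes (`exists_sweptTube`), the minimal-image lift inequality (`volume_setOf_exists_reprSym_add_latticeVec_mem_le`) — and the
Gaussian flux integral `∫ ‖w − v‖² dN(u,θ) dN(u,θ) ≤ 4 (3θ + ‖u‖²)` (`mmr_lintegral_norm_sub_sq_prod_gaussMeasure_le`);
`(N+1) ε_N³ = σ³` makes the bound uniform in `N`. What remains open for stmt-15330 is the same bound for the NON-constant
profiles of the family (non-invariant laws).

References: C. Cercignani, R. Illner, M. Pulvirenti, *The Mathematical Theory of Dilute Gases* (1994) App. 4.A; H. Spohn,
*Large Scale Dynamics of Interacting Particles* (1991) Part I §2.3.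
-/

noncomputable section

namespace Summit.AtomisticToContinuum.HydrodynamicLimit.Theorems.RestartPrinciple.AgeDuhamelForgetting

open scoped BigOperators Topology ENNReal
open MeasureTheory Set Filter
open Literature.MathematicalPhysics.KineticTheory Literature.Analysis.FluidPDE Literature.Analysis.FunctionSpaces
open Summit.AtomisticToContinuum.HydrodynamicLimit.Theorems.NearConstantShortTimeHL

/-- **The Gaussian flux integral of the relative-speed mark**: `∫ ‖w − v‖ · ‖v − w‖ dN(u,θ)(v) dN(u,θ)(w) ≤ 4 (3θ + ‖u‖²)`
(`‖v − w‖² ≤ 2‖v‖² + 2‖w‖²` and the Gaussian second moment `∫ ‖v‖² dN(u,θ) = 3θ + ‖u‖²`). [folklore] -/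
theorem mmr_lintegral_norm_sub_sq_prod_gaussMeasure_le (u : V3) {θ : ℝ} (hθ : 0 < θ) :
    ∫⁻ p, ENNReal.ofReal ‖p.2 - p.1‖ * ENNReal.ofReal ‖p.1 - p.2‖ ∂((gaussMeasure u θ).prod (gaussMeasure u θ)) ≤
      ENNReal.ofReal (4 * (3 * θ + ‖u‖ ^ 2)) := by
  -- adapted from `lintegral_norm_sub_prod_gaussMeasure_le` (`HardSphereMeanCollisionCount`)
  set γ := gaussMeasure u θ with hγ
  set g : V3 → ℝ≥0∞ := fun v => ENNReal.ofReal (2 * ‖v‖ ^ 2) with hg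
  have hgm : Measurable g := by rw [hg]; fun_prop
  have hle : ∀ p : V3 × V3, ENNReal.ofReal ‖p.2 - p.1‖ * ENNReal.ofReal ‖p.1 - p.2‖ ≤ g p.1 + g p.2 := by
    intro p
    rw [hg, ← ENNReal.ofReal_mul (norm_nonneg _), ← ENNReal.ofReal_add (by positivity) (by positivity)]
    refine ENNReal.ofReal_le_ofReal ?_
    have h1 := norm_sub_le p.1 p.2
    have h0 := norm_nonneg (p.1 - p.2)
    rw [norm_sub_rev p.2 p.1]
    nlinarith [sq_nonneg (‖p.1‖ - ‖p.2‖), mul_le_mul h1 h1 h0 (by positivity)]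
  have h1 : ∫⁻ p, g p.1 ∂(γ.prod γ) = ∫⁻ v, g v ∂γ := by
    calc ∫⁻ p, g p.1 ∂(γ.prod γ) = ∫⁻ v, ∫⁻ _w, g v ∂γ ∂γ := lintegral_prod _ (hgm.comp measurable_fst).aemeasurable
      _ = ∫⁻ v, g v ∂γ := by simp only [lintegral_const, measure_univ, mul_one]
  have h2 : ∫⁻ p, g p.2 ∂(γ.prod γ) = ∫⁻ v, g v ∂γ := by
    calc ∫⁻ p, g p.2 ∂(γ.prod γ) = ∫⁻ _v, ∫⁻ w, g w ∂γ ∂γ := lintegral_prod _ (hgm.comp measurable_snd).aemeasurable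
      _ = ∫⁻ v, g v ∂γ := by simp only [lintegral_const, measure_univ, mul_one]
  have h3 : ∫⁻ v, g v ∂γ = ENNReal.ofReal (2 * (3 * θ + ‖u‖ ^ 2)) := by
    have hfun : g = fun v => ENNReal.ofReal 2 * ENNReal.ofReal (‖v‖ ^ 2) := funext fun v => ENNReal.ofReal_mul zero_le_two
    rw [hfun, lintegral_const_mul _ (by fun_prop), hγ, lintegral_norm_sq_gaussMeasure_V3 u hθ,
      ← ENNReal.ofReal_mul zero_le_two]
  calc ∫⁻ p, ENNReal.ofReal ‖p.2 - p.1‖ * ENNReal.ofReal ‖p.1 - p.2‖ ∂(γ.prod γ)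
      ≤ ∫⁻ p, (g p.1 + g p.2) ∂(γ.prod γ) := lintegral_mono hle
    _ = ∫⁻ v, g v ∂γ + ∫⁻ v, g v ∂γ := by
        rw [lintegral_add_left (show Measurable (fun p : V3 × V3 => g p.1) from hgm.comp measurable_fst), h1, h2]
    _ = ENNReal.ofReal (4 * (3 * θ + ‖u‖ ^ 2)) := by
        rw [h3, ← ENNReal.ofReal_add (by positivity) (by positivity)]
        ring_nf

/-- **The mean relative-speed collision flux under the homogeneous Gibbs law** (sub-goal `mmr_collisionFlux_const`): for every
reduced density `0 < σ ≤ 1/2`, constant profiles `a, θ > 0`, `u`, every `N`, every hard-sphere flow `Φ` of `N + 1` spheres of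
diameter `ε_N = hsDiameter σ N` and every `s > 0`,
`(ε_N/(N+1)) · E_{G_N}[Σ_{collision times r ∈ [0,s]} Σ_{ordered contact pairs (i,k)} ‖vᵢ(r) − v_k(r)‖] ≤ 80 σ³ (3θ + ‖u‖²) s` —
the flux hypothesis of `mmr_momentum_of_collisionFlux` at constant profiles (`C_K = 80 σ³ (3θ + ‖u‖²)`, `e_K = 0`):
`localGibbsLaw_lintegral_le_of_le_collisionMarkSum` with the mark `‖vᵢ − v_k‖`, pair constant `5`, flow-invariance of `G_N`,
swept tubes and lift inequality of the tree, the Gaussian flux integral, and `(N+1) ε_N³ = σ³`. (For `N = 0` there is no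
ordered pair and the sum vanishes.) [cite: CIP1994, App. 4.A] -/
theorem mmr_collisionFlux_const : ∀ (σ : ℝ), 0 < σ → σ ≤ 1 / 2 → ∀ (a θ : ℝ) (u : V3), 0 < a → 0 < θ → ∀ (N : ℕ) (Φ : HardSphereFlow (Torus.geometry (Fin 3)) (hsDiameter σ N) (N + 1)) (s : ℝ), 0 < s → ENNReal.ofReal (hsDiameter σ N / ((N + 1 : ℕ) : ℝ)) * ∫⁻ z, (∑ᶠ r ∈ collisionTimes (Torus.geometry (Fin 3)) (hsDiameter σ N) (fun t => Φ.flow t z) ∩ Set.Icc 0 s, ∑ i, ∑ k, (if i ≠ k ∧ ‖(Torus.geometry (Fin 3)).sepVec (Φ.flow r z i).1 (Φ.flow r z k).1‖ = hsDiameter σ N then ENNReal.ofReal ‖(Φ.flow r z i).2 - (Φ.flow r z k).2‖ else 0)) ∂(localGibbsLaw σ (fun _ => a) (fun _ => u) (fun _ => θ) N Φ) ≤ ENNReal.ofReal (80 * σ ^ 3 * (3 * θ + ‖u‖ ^ 2) * s) := by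
  intro σ hσ hσ2 a θ u ha hθ N Φ s hs
  classical
  rcases Nat.eq_zero_or_pos N with hN0 | hN
  · -- one particle: there is no ordered pair `i ≠ k`, the collision sum vanishes identically
    subst hN0
    have hzero : ∀ z : Config (0 + 1) (Fin 3) T3,
        (∑ᶠ r ∈ collisionTimes (Torus.geometry (Fin 3)) (hsDiameter σ 0) (fun t => Φ.flow t z) ∩ Set.Icc 0 s,
          ∑ i, ∑ k, (if i ≠ k ∧ ‖(Torus.geometry (Fin 3)).sepVec (Φ.flow r z i).1 (Φ.flow r z k).1‖ = hsDiameter σ 0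
            then ENNReal.ofReal ‖(Φ.flow r z i).2 - (Φ.flow r z k).2‖ else 0)) = 0 := by
      intro z
      refine finsum_mem_of_eqOn_zero fun r _ => ?_
      exact Finset.sum_eq_zero fun i _ => Finset.sum_eq_zero fun k _ => if_neg fun h => h.1 (Fin.ext (by omega))
    simp only [hzero, lintegral_zero, mul_zero, zero_le]
  · set P := localGibbsLaw σ (fun _ => a) (fun _ => u) (fun _ => θ) N Φ with hPdef
    have hε : 0 < hsDiameter σ N := hsDiameter_pos hσ N
    have hpair : ∀ i j : Fin (N + 1), i ≠ j → ∀ T : Set T3, MeasurableSet T →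
        posGibbsMeasure (fun _ : T3 => (1 : ℝ)) (hsDiameter σ N) (N + 1) {x | x i - x j ∈ T} ≤ 5 * volume T :=
      fun i j hij T hT => posGibbs_pairEvent_le_five hσ.le hσ2 hN hij hT
    have hlift : ∀ B : Set V3, MeasurableSet B →
        volume {x : T3 | ∃ k : Fin 3 → ℤ, Torus.reprSym x + Torus.latticeVec k ∈ B} ≤ volume B := fun B hB => by
      simpa only [sub_zero] using volume_setOf_exists_reprSym_add_latticeVec_mem_le (0 : T3) hB
    have hbm : Measurable fun p : V3 × V3 => ENNReal.ofReal ‖p.1 - p.2‖ := by fun_prop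
    have hmain := localGibbsLaw_lintegral_le_of_le_collisionMarkSum hσ2 ha hθ u Φ
      (measurePreserving_flow_localGibbsLaw_const σ a θ u N Φ) (Cp := 5) hpair (fun h hh => exists_sweptTube hε hh)
      hlift hs hbm _ (fun z _ => le_rfl)
    have hflux := mmr_lintegral_norm_sub_sq_prod_gaussMeasure_le u hθ
    have key : hsDiameter σ N / ((N + 1 : ℕ) : ℝ) *
        (5 * (4 * s * ((N + 1 : ℕ) : ℝ) ^ 2 * hsDiameter σ N ^ 2) * (4 * (3 * θ + ‖u‖ ^ 2))) =
          80 * σ ^ 3 * (3 * θ + ‖u‖ ^ 2) * s := by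
      rw [← succ_mul_hsDiameter_pow_three σ N]
      have hn : ((N + 1 : ℕ) : ℝ) ≠ 0 := by positivity
      field_simp
      ring
    calc ENNReal.ofReal (hsDiameter σ N / ((N + 1 : ℕ) : ℝ)) * ∫⁻ z, (∑ᶠ r ∈ collisionTimes (Torus.geometry (Fin 3))
          (hsDiameter σ N) (fun t => Φ.flow t z) ∩ Set.Icc 0 s, ∑ i, ∑ k,
            (if i ≠ k ∧ ‖(Torus.geometry (Fin 3)).sepVec (Φ.flow r z i).1 (Φ.flow r z k).1‖ = hsDiameter σ N
              then ENNReal.ofReal ‖(Φ.flow r z i).2 - (Φ.flow r z k).2‖ else 0)) ∂P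
        ≤ ENNReal.ofReal (hsDiameter σ N / ((N + 1 : ℕ) : ℝ)) *
            (5 * ENNReal.ofReal (4 * s * ((N + 1 : ℕ) : ℝ) ^ 2 * hsDiameter σ N ^ 2) *
              ENNReal.ofReal (4 * (3 * θ + ‖u‖ ^ 2))) := mul_le_mul' le_rfl (hmain.trans (mul_le_mul' le_rfl hflux))
      _ = ENNReal.ofReal (80 * σ ^ 3 * (3 * θ + ‖u‖ ^ 2) * s) := by
          rw [← key, ← ENNReal.ofReal_ofNat 5, ← ENNReal.ofReal_mul (by norm_num),
            ← ENNReal.ofReal_mul (by positivity), ← ENNReal.ofReal_mul (div_nonneg hε.le (Nat.cast_nonneg _))]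

end Summit.AtomisticToContinuum.HydrodynamicLimit.Theorems.RestartPrinciple.AgeDuhamelForgetting

end
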